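import Summits.Ventures.HSemireg.WedgeHankelRecurrenceGaussChebyshevCosineProducts

/-!
# Venture HSemireg — **THE GARNIER–RAMARÉ PRODUCTS: `F_n = ∏_{k=1}^{⌊(n−1)∕2⌋} (1 + 4cos²(kπ∕n))` and `L_n = ∏_{k=1}^{⌊n∕2⌋} (1 + 4cos²((2k−1)π∕2n))` for `n ≥ 1`** (the square roots of the unpaired products
# `F_n² = ∏_{k=1}^{n−1} (1 + 4cos²(kπ∕n))` (N527) and `L_n² = ∏_{k=0}^{n−1} (1 + 4cos²((2k+1)π∕2n))` (N529), paired by the symmetry `k ↦ n − k` resp. `k ↦ n − 1 − k` under which the cosine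
# changes sign, the unpaired middle factor being `1 + 4cos²(π∕2) = 1`)

HONEST FRAMING. Part of the Lean index of the computation cell `pub-hsemireg` (seat p10 gen 49, Sunday typer «UNIFORM-IN-n»).  Real finite products only (Mathlib `Finset.prod_range_add`,
`Finset.prod_range_reflect`, `Real.cos_pi_sub`) on top of N527 and N529; no variety, no cohomology theory, no sheaf, no Ext group and no semiregularity map is constructed here; nothing here says that
HC / HC_CM / HC_AV holds; no Literature fact (unproved `Prop`) is declared or used.  Custodian versions as in `WedgeHankelSiegelIdeal` (1/3).
SOURCES (cited).  N. Garnier, O. Ramaré, *Fibonacci numbers and trigonometric identities*, Fibonacci Quart. 46∕47 (2008∕09) 56–61, Thm 1 (`F_n = ∏_{k=1}^{⌊(n−1)∕2⌋} (1 + 4cos²(kπ∕n))`) and its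
Lucas companion; D. Jarden, *Recurring Sequences* (Riveon Lematematika, 1966) for the classical forms `F_n = ∏ (3 + 2cos(2kπ∕n))` (equivalent by `1 + 4cos² x = 3 + 2cos 2x`).
PROOF TYPED HERE.  (1) Two pairing lemmas: if `f(q + k) = f(q − 1 − k)` for `k < q` then `∏_{k<2q} f(k) = (∏_{k<q} f(k))²`, and if moreover `f(q) = 1` and `f(q + 1 + k) = f(q − 1 − k)` then
`∏_{k<2q+1} f(k) = (∏_{k<q} f(k))²` (`Finset.prod_range_add`, `prod_range_succ'`, `prod_range_reflect`); (2) the symmetry of `k ↦ 1 + 4cos²((k+1)π∕n)` (`cos(π − x) = −cos x`) and the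
middle value `cos(π∕2) = 0`; (3) square roots by `pow_left_inj₀` (both sides `≥ 0`); (4) the same for `k ↦ 1 + 4cos²((2k+1)π∕2n)`.
DEDUP DISCLOSURE (`rg -n 'prod_range_reflect|GarnierRamare|1 \\+ 4 \\* Real.cos' Summits/Ventures/HSemireg Literature`, 2026-09-04): only N527 ∕ N529 (the squared, unpaired forms); Mathlib has no
Fibonacci–cosine product; 0 hits for the 9 names below.

WHAT IS IN THE TREE.  N527 `fib_succ_sq_eq_prod_cos`; N529 `lucas_sq_eq_prod_cos`; Mathlib `Finset.prod_range_add`, `Finset.prod_range_succ'`, `Finset.prod_range_reflect`, `Real.cos_pi_sub`,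
`Real.cos_pi_div_two`, `pow_left_inj₀`, `Nat.even_or_odd'`, `Nat.fib_mono`.
THIS FILE (namespace `Summit.Ventures.HSemireg.Wedge.HankelOuter` continued; CHAINED on N529; 0 definitions):
* §1295 `prod_range_two_mul_eq_sq_of_symm`, `prod_range_two_mul_add_one_eq_sq_of_symm` (pairing lemmas), `cast_sub_one_sub_of_lt`; **`fib_two_mul_add_one_eq_prod_cos`** (`F_{2q+1} = ∏_{k<q} (1 + 4cos²((k+1)π∕(2q+1)))`),
  **`fib_two_mul_add_two_eq_prod_cos_sq`** (`F_{2q+2} = ∏_{k<q} (1 + 4cos²((k+1)π∕(2q+2)))`), **`fib_eq_prod_cos`** (`F_n = ∏_{k<⌊(n−1)∕2⌋} (1 + 4cos²((k+1)π∕n))`, `n ≠ 0`);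
  **`lucas_two_mul_eq_prod_cos_sq`** (`L_{2q} = ∏_{k<q} (1 + 4cos²((2k+1)π∕4q))`, `q ≠ 0`), **`lucas_two_mul_add_one_eq_prod_cos_sq`** (`L_{2q+1} = ∏_{k<q} (1 + 4cos²((2k+1)π∕(4q+2)))`),
  **`lucas_eq_prod_cos`** (`L_n = 2F_{n+1} − F_n = ∏_{k<⌊n∕2⌋} (1 + 4cos²((2k+1)π∕2n))`, `n ≠ 0`).
CAVEATS.  `L_n` is written `2F_{n+1} − F_n`.  Nothing Ext-side.  New names only.
-/

open Module Polynomial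
open scoped Matrix Polynomial

namespace Summit.Ventures.HSemireg.Wedge.HankelOuter

/-! ## §1295. The Garnier–Ramaré products -/

/-! ### Pairing lemmas -/

/-- Pairing, even length: if `f(q + k) = f(q − 1 − k)` for all `k < q` then `∏_{k<2q} f(k) = (∏_{k<q} f(k))²`. [this file, §1295] -/
theorem prod_range_two_mul_eq_sq_of_symm {f : ℕ → ℝ} {q : ℕ} (hsymm : ∀ k < q, f (q + k) = f (q - 1 - k)) :
    ∏ k ∈ Finset.range (2 * q), f k = (∏ k ∈ Finset.range q, f k) ^ 2 := by
  rw [two_mul, Finset.prod_range_add, sq]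
  congr 1
  rw [← Finset.prod_range_reflect f q]
  exact Finset.prod_congr rfl fun k hk => hsymm k (Finset.mem_range.mp hk)

/-- Pairing, odd length: if `f(q) = 1` and `f(q + 1 + k) = f(q − 1 − k)` for all `k < q` then `∏_{k<2q+1} f(k) = (∏_{k<q} f(k))²`. [this file, §1295] -/
theorem prod_range_two_mul_add_one_eq_sq_of_symm {f : ℕ → ℝ} {q : ℕ} (hmid : f q = 1) (hsymm : ∀ k < q, f (q + 1 + k) = f (q - 1 - k)) :
    ∏ k ∈ Finset.range (2 * q + 1), f k = (∏ k ∈ Finset.range q, f k) ^ 2 := by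
  rw [show 2 * q + 1 = q + (q + 1) by ring, Finset.prod_range_add, sq]
  congr 1
  rw [Finset.prod_range_succ', add_zero, hmid, mul_one, ← Finset.prod_range_reflect f q]
  exact Finset.prod_congr rfl fun k hk => by
    rw [show q + (k + 1) = q + 1 + k by ring]
    exact hsymm k (Finset.mem_range.mp hk)

/-- Cast of `q − 1 − k` to `ℝ` for `k < q`. [this file, §1295] -/
theorem cast_sub_one_sub_of_lt {q k : ℕ} (hk : k < q) : ((q - 1 - k : ℕ) : ℝ) = (q : ℝ) - 1 - k := by
  rw [Nat.sub_sub, Nat.cast_sub (by omega : 1 + k ≤ q)]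
  push_cast
  ring

/-! ### Fibonacci -/

/-- **`F_{2q+1} = ∏_{k<q} (1 + 4cos²((k+1)π∕(2q+1)))`.** [Garnier–Ramaré 2008, Thm 1; this file, §1295] -/
theorem fib_two_mul_add_one_eq_prod_cos (q : ℕ) : (Nat.fib (2 * q + 1) : ℝ) = ∏ k ∈ Finset.range q, (1 + 4 * Real.cos ((k + 1) * Real.pi / (2 * q + 1)) ^ 2) := by
  have h := fib_succ_sq_eq_prod_cos (2 * q)
  push_cast at h
  rw [prod_range_two_mul_eq_sq_of_symm] at h
  · exact (pow_left_inj₀ (Nat.cast_nonneg _) (Finset.prod_nonneg fun k _ => by positivity) two_ne_zero).mp h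
  · intro k hk
    have hq : (2 * (q : ℝ) + 1) ≠ 0 := by positivity
    push_cast
    rw [cast_sub_one_sub_of_lt hk, show ((q : ℝ) - 1 - k + 1) * Real.pi / (2 * q + 1) = Real.pi - ((q : ℝ) + k + 1) * Real.pi / (2 * q + 1) by field_simp; ring,
      Real.cos_pi_sub, neg_sq]

/-- **`F_{2q+2} = ∏_{k<q} (1 + 4cos²((k+1)π∕(2q+2)))`** (the middle factor `1 + 4cos²(π∕2) = 1` drops out). [Garnier–Ramaré 2008, Thm 1; this file, §1295] -/
theorem fib_two_mul_add_two_eq_prod_cos_sq (q : ℕ) : (Nat.fib (2 * q + 2) : ℝ) = ∏ k ∈ Finset.range q, (1 + 4 * Real.cos ((k + 1) * Real.pi / (2 * q + 2)) ^ 2) := by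
  have h := fib_succ_sq_eq_prod_cos (2 * q + 1)
  push_cast at h
  rw [show (2 * (q : ℝ) + 1 + 1) = 2 * q + 2 by ring, show 2 * q + 1 + 1 = 2 * q + 2 by ring, prod_range_two_mul_add_one_eq_sq_of_symm] at h
  · exact (pow_left_inj₀ (Nat.cast_nonneg _) (Finset.prod_nonneg fun k _ => by positivity) two_ne_zero).mp h
  · have hq : ((q : ℝ) + 1) ≠ 0 := by positivity
    rw [show (2 * (q : ℝ) + 2) = (q + 1) * 2 by ring, mul_div_mul_left _ _ hq, Real.cos_pi_div_two]
    norm_num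
  · intro k hk
    have hq : (2 * (q : ℝ) + 2) ≠ 0 := by positivity
    push_cast
    rw [cast_sub_one_sub_of_lt hk, show ((q : ℝ) - 1 - k + 1) * Real.pi / (2 * q + 2) = Real.pi - ((q : ℝ) + 1 + k + 1) * Real.pi / (2 * q + 2) by field_simp; ring,
      Real.cos_pi_sub, neg_sq]

/-- **`F_n = ∏_{k<⌊(n−1)∕2⌋} (1 + 4cos²((k+1)π∕n))`** for `n ≠ 0` (Garnier–Ramaré). [Garnier–Ramaré 2008, Thm 1; this file, §1295] -/
theorem fib_eq_prod_cos {n : ℕ} (hn : n ≠ 0) : (Nat.fib n : ℝ) = ∏ k ∈ Finset.range ((n - 1) / 2), (1 + 4 * Real.cos ((k + 1) * Real.pi / n) ^ 2) := by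
  obtain ⟨q, rfl | rfl⟩ := Nat.even_or_odd' n
  · obtain ⟨p, rfl⟩ : ∃ p, q = p + 1 := ⟨q - 1, by omega⟩
    rw [show 2 * (p + 1) = 2 * p + 2 by ring, show (2 * p + 2 - 1) / 2 = p by omega]
    exact_mod_cast fib_two_mul_add_two_eq_prod_cos_sq p
  · rw [show (2 * q + 1 - 1) / 2 = q by omega]
    exact_mod_cast fib_two_mul_add_one_eq_prod_cos q

/-! ### Lucas -/

/-- **`L_{2q} = 2F_{2q+1} − F_{2q} = ∏_{k<q} (1 + 4cos²((2k+1)π∕4q))`** for `q ≠ 0`. [Garnier–Ramaré 2008; this file, §1295] -/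
theorem lucas_two_mul_eq_prod_cos_sq {q : ℕ} (hq : q ≠ 0) :
    2 * (Nat.fib (2 * q + 1) : ℝ) - (Nat.fib (2 * q) : ℝ) = ∏ k ∈ Finset.range q, (1 + 4 * Real.cos ((2 * k + 1) * Real.pi / (4 * q)) ^ 2) := by
  have h := lucas_sq_eq_prod_cos (n := 2 * q) (by omega)
  push_cast at h
  rw [show (2 * (2 * (q : ℝ))) = 4 * q by ring, prod_range_two_mul_eq_sq_of_symm] at h
  · have h0 : (0 : ℝ) ≤ 2 * (Nat.fib (2 * q + 1) : ℝ) - (Nat.fib (2 * q) : ℝ) := by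
      have := Nat.fib_mono (Nat.le_succ (2 * q))
      have : (Nat.fib (2 * q) : ℝ) ≤ Nat.fib (2 * q + 1) := by exact_mod_cast this
      linarith [Nat.cast_nonneg (α := ℝ) (Nat.fib (2 * q))]
    exact (pow_left_inj₀ h0 (Finset.prod_nonneg fun k _ => by positivity) two_ne_zero).mp h
  · intro k hk
    have hq' : (4 * (q : ℝ)) ≠ 0 := by positivity
    push_cast
    rw [cast_sub_one_sub_of_lt hk, show (2 * ((q : ℝ) - 1 - k) + 1) * Real.pi / (4 * q) = Real.pi - (2 * ((q : ℝ) + k) + 1) * Real.pi / (4 * q) by field_simp; ring,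
      Real.cos_pi_sub, neg_sq]

/-- **`L_{2q+1} = 2F_{2q+2} − F_{2q+1} = ∏_{k<q} (1 + 4cos²((2k+1)π∕(4q+2)))`.** [Garnier–Ramaré 2008; this file, §1295] -/
theorem lucas_two_mul_add_one_eq_prod_cos_sq (q : ℕ) :
    2 * (Nat.fib (2 * q + 2) : ℝ) - (Nat.fib (2 * q + 1) : ℝ) = ∏ k ∈ Finset.range q, (1 + 4 * Real.cos ((2 * k + 1) * Real.pi / (4 * q + 2)) ^ 2) := by
  have h := lucas_sq_eq_prod_cos (n := 2 * q + 1) (by omega)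
  push_cast at h
  rw [show (2 * (2 * (q : ℝ) + 1)) = 4 * q + 2 by ring, show 2 * q + 1 + 1 = 2 * q + 2 by ring, prod_range_two_mul_add_one_eq_sq_of_symm] at h
  · have h0 : (0 : ℝ) ≤ 2 * (Nat.fib (2 * q + 2) : ℝ) - (Nat.fib (2 * q + 1) : ℝ) := by
      have := Nat.fib_mono (Nat.le_succ (2 * q + 1))
      have : (Nat.fib (2 * q + 1) : ℝ) ≤ Nat.fib (2 * q + 2) := by exact_mod_cast this
      linarith [Nat.cast_nonneg (α := ℝ) (Nat.fib (2 * q + 1))]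
    exact (pow_left_inj₀ h0 (Finset.prod_nonneg fun k _ => by positivity) two_ne_zero).mp h
  · have hq : (2 * (q : ℝ) + 1) ≠ 0 := by positivity
    rw [show (4 * (q : ℝ) + 2) = (2 * q + 1) * 2 by ring, mul_div_mul_left _ _ hq, Real.cos_pi_div_two]
    norm_num
  · intro k hk
    have hq : (4 * (q : ℝ) + 2) ≠ 0 := by positivity
    push_cast
    rw [cast_sub_one_sub_of_lt hk, show (2 * ((q : ℝ) - 1 - k) + 1) * Real.pi / (4 * q + 2) = Real.pi - (2 * ((q : ℝ) + 1 + k) + 1) * Real.pi / (4 * q + 2) by field_simp; ring,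
      Real.cos_pi_sub, neg_sq]

/-- **`L_n = 2F_{n+1} − F_n = ∏_{k<⌊n∕2⌋} (1 + 4cos²((2k+1)π∕2n))`** for `n ≠ 0` (Garnier–Ramaré, Lucas companion). [Garnier–Ramaré 2008; this file, §1295] -/
theorem lucas_eq_prod_cos {n : ℕ} (hn : n ≠ 0) :
    2 * (Nat.fib (n + 1) : ℝ) - (Nat.fib n : ℝ) = ∏ k ∈ Finset.range (n / 2), (1 + 4 * Real.cos ((2 * k + 1) * Real.pi / (2 * n)) ^ 2) := by
  obtain ⟨q, rfl | rfl⟩ := Nat.even_or_odd' n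
  · rw [show 2 * q / 2 = q by omega, lucas_two_mul_eq_prod_cos_sq (by omega)]
    push_cast
    exact Finset.prod_congr rfl fun k _ => by ring_nf
  · rw [show (2 * q + 1) / 2 = q by omega, show 2 * q + 1 + 1 = 2 * q + 2 by ring, lucas_two_mul_add_one_eq_prod_cos_sq]
    push_cast
    exact Finset.prod_congr rfl fun k _ => by ring_nf

end Summit.Ventures.HSemireg.Wedge.HankelOuter
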